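import Summits.CriticalPhenomena.Ising3DConformalLimit.Theorems.PerfectScreeningCoulombImpliesNontrivialGapOfBinder
import Summits.CriticalPhenomena.Ising3DConformalLimit.Theorems.PerfectScreeningCoulombImpliesNontrivialGaussianKillsBinder
import Summits.CriticalPhenomena.Ising3DConformalLimit.Theorems.PerfectScreeningCoulombImpliesNontrivialBlockVariance
import Summits.CriticalPhenomena.Ising3DConformalLimit.Theorems.CoulombImpliesNontrivial.Negative.Antecedent
import Literature.Probability.LatticeModels.HighDimPointwiseTriviality
import HarnessLib

/-!
# Line `quartic-relevance` for crux `CoulombImpliesNontrivial` (stmt-CriticalPhenomena-13885)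
# — STRATEGIST SKELETON v1 (crux-strategist p1 "wall-breaker", 2026-08-17)

Crux (route PerfectScreening, r3), verbatim the route decl
`Summit.CriticalPhenomena.Ising3DConformalLimit.Theses.PerfectScreening.CoulombImpliesNontrivial`:
`(∃ c > 0, ∀ x ≠ 0, c/‖x‖ ≤ criticalTwoPoint 3 x) → ∀ ρ S, (ρ > 0 on (0,1]) →
  HasPointwiseScalingLimit (criticalCorr 3) ρ S → IsNondegenerateTwoPoint S → HasNontrivialU4 S`.

## Idea (new on this crux): INFRARED INSTABILITY OF THE GAUSSIAN FIXED POINT IN `d = 3` + LEE–YANG SLAVING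

Every dead line of this crux (SketchPub / isotherm, Sketch / capacity, merging-is-expected-screening / S_B,
CoulombBranchIsFree) needed a LOWER bound on a macroscopic quantity (merging, depletion, hyperscaling, one-arm,
Lee–Yang gap) and died because all available leans hold verbatim in the two "impostor" worlds where a Coulomb
two-point function coexists with a Gaussian limit: n.n. Ising on `ℤ^d`, `d ≥ 5`, and the `d = 3` tricritical
cartoon W₃ (leads c3/c4/c8, `Lines/*-dead.md`). This line does not ask for a floor. It asks for a FLOW
inequality — the rigorous shadow of the one-loop `β`-function at the Gaussian fixed point — and relocates the
two keys every proof must carry: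

* K_d (`d < 4`): the tree-level scaling factor of the block coupling under `L ↦ 2L` is `2^{4-d}`; it is the
  number `2` in `stub_treeScaleRatio` (pure two-point bookkeeping under Coulomb, PROVABLE) — `> 1` iff `d < 4`;
* K_int (not saturated by Gaussian data): Lee–Yang. Newman's inequalities give `|κ₆(M_L)| ≤ C₆ |κ₄(M_L)|^{3/2}`
  for the critical block spin (`stub_newmanSixth`, PROVABLE from the tree's Lee–Yang lattice-law package):
  the sextic coupling is SLAVED to the quartic one, `ĝ₆ ≲ g^{3/2} ≪ g`. This is violated POLYNOMIALLY in W₃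
  (there `ĝ₆ ≍ 1/log L`, `g ≍ 1/log² L`), not by a logarithm in an amplitude: W₃ escapes the Gaussian fixed
  point's instability exactly by feeding `φ⁴` from a marginal `φ⁶`, which Lee–Yang forbids;
* the one OPEN stub `stub_vertexQuasiMonotone` (the heart): the BOX VERTEX
  `λ_L := F(L)/T(L)`, `F(L) = 3⟨M_L²⟩² − ⟨M_L⁴⟩ = −Σ_{Λ_L⁴} U₄ ≥ 0`, `T(L)` = tree diagram of the box,
  cannot drop by more than a factor `1 − ε` under `L ↦ 2L` once the dimensionless coupling `g_L = F/V²` is small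
  AND `κ₆` is slaved (`κ₆² ≤ η₀ (V·F)²`). Physically: `λ_{2L} = λ_L (1 − c₁ g_L + O(g_L², ĝ₆))` (one loop);
  the statement is the non-perturbative LOWER bound on the `β`-function near `g = 0` that Aizenman lists as open
  (Aizenman 2021, arXiv:2112.04248, §11 Q2: "non-perturbative bounds on the beta function"). It is CONSISTENT
  with every impostor world (holds or is vacuous in `d ≥ 5`, `d = 4`, W₃, GFF, sgn(GFF), 2D Ising), so — unlike
  S_B, R, UCI, 15591, 4945, X_thin, CutDensityFloor — no transfer/impostor theorem forbids proving it with
  class-universal tools; what it needs is perturbation theory around the Gaussian fixed point justified by the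
  IR-smallness of `g_L` that the contradiction hypothesis itself supplies (plus the Lee–Yang analytic control of
  block laws). No single currents, no defects, no isotherm. TRANSFER ANCHOR: in Dyson's hierarchical Ising model the
  one-step version of this stub is a THEOREM — Hara–Hattori–Watanabe 2001 Prop. 3.1 (3.20), in tree as
  `HierarchicalRG.TruncFlow.four_T_ge` (`μ₄ ↦ ≥ M⁴(μ₄ − 15μ₆ζ − 84μ₄²ζ²)`, from the closed flow `μ₄' = 16μ₂μ₄ − 30μ₆`
  + Newman); the missing structure on `ℤ³` is the closed single-law flow, i.e. control of inter-block correlations.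

## Composition (kernel-checked here, crux BY NAME)

Coulomb, limit `(ρ,S)` non-degenerate, suppose `¬HasNontrivialU4 S`. Landed: `g_L → 0`
(`stub_gaussianKillsBinder` + `stub_blockVariance`, line SketchPub S4/S7) and `F(L) ≥ 2 V_L > 0`
(`blockPackage_reverse`: `V = m + 2Σbᵢ`, `F = 2m + 12Σbᵢ² − 8Σbᵢ`, `bᵢ ≥ 1` — the `σ² = 1` / Lee–Yang lattice
structure; a lattice GFF has `F ≡ 0` and escapes here). `stub_newmanSixth` turns `g_L ≤ g₁` into the slaving
hypothesis; `stub_vertexQuasiMonotone` (ε = 1/4) gives `F(2L)·T(L) ≥ (3/4)·F(L)·T(2L)`; `stub_treeScaleRatio`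
gives `T(2L)V_L² ≥ (3/2)·T(L)V_{2L}²` eventually; hence `g_{2L} ≥ (9/8) g_L ≥ g_L` for all large `L` with
`g_L ≤ g₁`, so `k ↦ g_{2^k L₃}` is bounded below by `g_{L₃} > 0` — contradicting `g_L → 0`.

DISPROOF USED (`Cruxes/CoulombImpliesNontrivial/Disproof.lean`): `not_twoPointOnly` / `not_latticeShadow`
(honoured: the lattice GFF satisfies A, B, C but has `F ≡ 0`, the composition uses `F ≥ 2V` from the ±1 lattice
law); §5 / `Negative/DimensionFive` (in `d ≥ 5` the ratio of `stub_treeScaleRatio` is `2^{4-d} < 1` and the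
iteration gives nothing — d-specificity sits in an explicit number, not in a lattice count shared by W₃); §7(iv)
N-uniformity (constants of A are those of n.n. Ising₃, no uniformity in the single-site law claimed); §4
`canonical_of_coulomb` is what `stub_treeScaleRatio` rests on (`ρ(δ/2)/ρ(δ) → √2`).
-/

noncomputable section

namespace Summit.CriticalPhenomena.Ising3DConformalLimit.Cruxes.CoulombImpliesNontrivial.QuarticRelevance

open Literature.Probability.LatticeModels Filter Set Finset
open scoped Topology BigOperators

/-! ## Block functionals of the critical nearest-neighbour Ising model on `ℤ³` (`Λ_L = box 3 L = {-L,…,L}³`) -/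

/-- `V_L = ⟨M_L²⟩⁺_{β_c}`, `M_L = Σ_{x ∈ Λ_L} σ_x`. -/
def bV (L : ℕ) : ℝ := plusExpect 3 (criticalBeta 3) 0 (fun σ => (∑ x ∈ box 3 L, spinAt x σ) ^ 2)

/-- `⟨M_L⁴⟩⁺_{β_c}`. -/
def bM4 (L : ℕ) : ℝ := plusExpect 3 (criticalBeta 3) 0 (fun σ => (∑ x ∈ box 3 L, spinAt x σ) ^ 4)

/-- `⟨M_L⁶⟩⁺_{β_c}`. -/
def bM6 (L : ℕ) : ℝ := plusExpect 3 (criticalBeta 3) 0 (fun σ => (∑ x ∈ box 3 L, spinAt x σ) ^ 6)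

/-- The QUARTIC MASS `F(L) = 3V_L² − ⟨M_L⁴⟩ = −κ₄(M_L) = −Σ_{Λ_L⁴} U₄ ≥ 0` (Lebowitz). -/
def quarticMass (L : ℕ) : ℝ := 3 * bV L ^ 2 - bM4 L

/-- The SEXTIC CUMULANT `κ₆(M_L) = ⟨M⁶⟩ − 15⟨M⁴⟩⟨M²⟩ + 30⟨M²⟩³` (odd moments vanish at `h = 0`). -/
def sexticCumulant (L : ℕ) : ℝ := bM6 L - 15 * bM4 L * bV L + 30 * bV L ^ 3

/-- The TREE FUNCTIONAL of the box: `T(L) = Σ_{w ∈ Λ_{2L}} (Σ_{x ∈ Λ_L} ⟨σ_xσ_w⟩_{β_c})⁴` — the tree diagram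
`Σ_w Π_{i=1}^4 ⟨σ_{x_i}σ_w⟩` summed over `(x_i) ∈ Λ_L⁴`, vertex `w` in the doubled box. Under Coulomb and a
pointwise limit, `T(L) ≍ ρ(1/L)^{-8} L^{15}`. -/
def treeBox (L : ℕ) : ℝ := ∑ w ∈ box 3 (2 * L), (∑ x ∈ box 3 L, criticalTwoPoint 3 (x - w)) ^ 4

/-- The block coupling (renormalised Binder cumulant) `g_L = F(L)/V_L²`. -/
def binder (L : ℕ) : ℝ := quarticMass L / bV L ^ 2

/-! ## The three registered stubs -/

/-- **STUB A `stub_vertexQuasiMonotone` (XL — THE OPEN HEART; the non-perturbative lower bound on the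
`β`-function of the block coupling at the Gaussian fixed point).** For every `ε > 0` there are thresholds
`g₀, η₀ > 0` and `L₀` such that for `L ≥ L₀`: if the block coupling is small, `F(L) ≤ g₀ V_L²`, and the sextic
cumulant is SLAVED, `κ₆(M_L)² ≤ η₀ (V_L F(L))²` (i.e. `ĝ₆ ≤ √η₀ g`), then the box vertex `λ_L = F(L)/T(L)` drops
by at most the factor `1 − ε` under doubling: `(1 − ε) F(L) T(2L) ≤ F(2L) T(L)`. One-loop heuristics:
`λ_{2L} = λ_L(1 − c₁ g_L + O(g_L²) + O(ĝ₆))`. Consistent with (holds or is vacuous in) n.n. Ising `d ≥ 5`, `d = 4`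
(ADC21), the tricritical cartoon W₃ (slaving fails there), lattice GFF (`F ≡ 0`), sgn(GFF), 2D Ising and the real
Ising₃ fixed point (`g_L → g* > 0`, hypothesis eventually void); believed for every reflection-positive even
ferromagnet. No printed proof technique: the intended engine is block-spin perturbation theory around the
Gaussian fixed point with remainders controlled by the Lee–Yang analytic structure of block laws
(all positive combinations of sub-blocks are Lee–Yang, Lieb–Sokal 1981; joint cumulants of order `2n` are
`O(g^{n/2})` by polarisation of Newman's bounds). SOLVED SIBLING (transfer anchor): for Dyson's hierarchical Ising
model the one-step analogue is Hara–Hattori–Watanabe 2001 Prop. 3.1 (3.20)/(3.35),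
`μ₄(T) ≥ M_T⁴(A₄ − 15A₆ζ_T − 84A₄²ζ_T²)` — quartic coupling after one RG step ≥ scaling × (quartic − C·sextic −
C'·quartic²) — PROVED in tree as `Literature.Barriers.CriticalPhenomena.HierarchicalRG.TruncFlow.four_T_ge` from
the closed cumulant flow `μ₄' = 16μ₂μ₄ − 30μ₆` and Newman positivity; what `ℤ³` lacks is the closed flow (inter-block
correlations), not the inequality. [cite: Aizenman2021, §10.3 and §11 Q2 (non-perturbative bounds on the beta function: open)]
[cite: HaraHattoriWatanabe2001, Proposition 3.1 (3.20) and (3.35)] [cite: Newman1975, Thm 3 and Thm 7]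
[cite: AizenmanDuminilCopinAnnals2021, §1.3 (g_L, d = 4 marginal flow)] -/
theorem stub_vertexQuasiMonotone :
    ∀ ε : ℝ, 0 < ε → ∃ g₀ η₀ : ℝ, 0 < g₀ ∧ 0 < η₀ ∧ ∃ L₀ : ℕ, ∀ L : ℕ, L₀ ≤ L →
      quarticMass L ≤ g₀ * bV L ^ 2 →
      sexticCumulant L ^ 2 ≤ η₀ * (bV L * quarticMass L) ^ 2 →
      (1 - ε) * (quarticMass L * treeBox (2 * L)) ≤ quarticMass (2 * L) * treeBox L := by
  sorry

/-- **STUB B `stub_treeScaleRatio` (M/L — two-point bookkeeping; carries the `d = 3` key).** Under the Coulomb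
antecedent and for a non-degenerate pointwise limit `(ρ, S)`: `T(2L)·V_L² / (T(L)·V_{2L}²) → 2`. Proof sketch:
`canonical_of_coulomb` (landed, `Negative/Antecedent.lean`) gives scale covariance with `Δ = 1/2` and
`ρ(δ/2)/ρ(δ) → √2`; Riemann sums with the integrable `1/|u−v|` singularity dominated through the infrared bound
and `rho_sq_le_of_coulomb` give `V_L ∼ J ρ(1/L)⁻² L⁶`, `T(L) ∼ I ρ(1/L)⁻⁸ L¹⁵`; hence the ratio tends to
`2¹⁵·2⁻¹² · (√2)^{-8+4} = 2 = 2^{4-d}|_{d=3}` (in `ℤ^d` the same computation gives `2^{4-d}`). [cite: Lamperti1962, Theorem 2] -/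
theorem stub_treeScaleRatio :
    (∃ c : ℝ, 0 < c ∧ ∀ x : Site 3, x ≠ 0 → c / ‖x‖ ≤ criticalTwoPoint 3 x) →
      ∀ (ρ : ℝ → ℝ) (S : CorrFamily 3), (∀ δ ∈ Set.Ioc (0:ℝ) 1, 0 < ρ δ) →
        HasPointwiseScalingLimit (criticalCorr 3) ρ S → IsNondegenerateTwoPoint S →
        Tendsto (fun L : ℕ => treeBox (2 * L) * bV L ^ 2 / (treeBox L * bV (2 * L) ^ 2)) atTop (𝓝 2) := by
  sorry

/-- **STUB C `stub_newmanSixth` (M — Lee–Yang slaving of the sextic cumulant; carries the interaction key).**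
`κ₆(M_L)² ≤ C₆ (−κ₄(M_L))³` for the critical block spin, uniformly in `L`. From the tree's Lee–Yang lattice-law
package (`stub_blockLaw`, `stub_leeYangPackage`: `Σ_k p_k e^{tk} = cosh^m t · Πᵢ (1 + bᵢ sinh² t)`, `bᵢ ≥ 1`):
`−κ₄ = 2m + Σᵢ(12bᵢ² − 8bᵢ) ≥ 2m + 4Σbᵢ²` and `κ₆ = 16m + Σᵢ(240bᵢ³ − 240bᵢ² + 32bᵢ) ≤ 16m + 32Σbᵢ² +
240(Σbᵢ²)^{3/2}`, so `κ₆ ≤ 16X + 30X^{3/2}` with `X = −κ₄`; `C₆ = 46²` does it (`X < 1` forces `m = n = 0`).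
Newman 1975 Thm 3/7 (`|u_{2n}| ≤ ((2n)!/n)(u₄/12)^{n/2}` in Hadamard form). -/
theorem stub_newmanSixth :
    ∃ C₆ : ℝ, 0 ≤ C₆ ∧ ∀ L : ℕ, sexticCumulant L ^ 2 ≤ C₆ * quarticMass L ^ 3 := by
  sorry

/-! ## Proved helpers -/

/-- `F(L) ≥ 2 V_L`: the Lee–Yang lattice structure of the ±1 block (`V = m + 2Σbᵢ`, `F = 2m + 12Σbᵢ² − 8Σbᵢ`,
`bᵢ ≥ 1`, landed `blockPackage_reverse`). In particular `g_L ≥ 2/V_L > 0`. -/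
theorem two_mul_bV_le_quarticMass (L : ℕ) : 2 * bV L ≤ quarticMass L := by
  obtain ⟨m, n, b, hb, -, hV, -, hF⟩ :=
    Summit.CriticalPhenomena.Ising3DConformalLimit.PerfectScreeningCoulombImpliesNontrivial.blockPackage_reverse L
  have h1 : ∑ i, b i ≤ ∑ i, b i ^ 2 :=
    Finset.sum_le_sum fun i _ => by nlinarith [hb i]
  unfold quarticMass bV bM4
  linarith [hV, hF, h1]

/-- `T(L) ≥ 1 > 0` (the term `w = 0`, `x = 0` alone contributes `⟨σ₀σ₀⟩⁴ = 1`). -/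
theorem treeBox_pos (L : ℕ) : 0 < treeBox L := by
  unfold treeBox
  have hw : (0 : Site 3) ∈ box 3 (2 * L) := zero_mem_box 3 (2 * L)
  have hx : (0 : Site 3) ∈ box 3 L := zero_mem_box 3 L
  have hinner : ∀ w : Site 3, 0 ≤ ∑ x ∈ box 3 L, criticalTwoPoint 3 (x - w) := fun w =>
    Finset.sum_nonneg fun x _ => criticalTwoPoint_nonneg' _
  have h1 : (1 : ℝ) ≤ ∑ x ∈ box 3 L, criticalTwoPoint 3 (x - 0) := by
    have := Finset.single_le_sum (f := fun x => criticalTwoPoint 3 (x - 0))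
      (fun x _ => criticalTwoPoint_nonneg' _) hx
    simpa [criticalTwoPoint_zero'] using this
  have h2 : (1 : ℝ) ≤ (∑ x ∈ box 3 L, criticalTwoPoint 3 (x - 0)) ^ 4 := by
    have := pow_le_pow_left₀ zero_le_one h1 4
    simpa using this
  have h3 : (∑ x ∈ box 3 L, criticalTwoPoint 3 (x - 0)) ^ 4 ≤
      ∑ w ∈ box 3 (2 * L), (∑ x ∈ box 3 L, criticalTwoPoint 3 (x - w)) ^ 4 :=
    Finset.single_le_sum (f := fun w => (∑ x ∈ box 3 L, criticalTwoPoint 3 (x - w)) ^ 4)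
      (fun w _ => pow_nonneg (hinner w) 4) hw
  linarith

/-! ## The composition: A → B → C → crux (by name) -/

/-- **The composition, parametric form**: statements A, B, C imply the crux (stated here in unfolded form;
`CoulombImpliesNontrivial_of` below applies it to the three `stub_*` and concludes the route decl BY NAME). -/
theorem crux_of_vertexQuasiMonotone
    (hA : ∀ ε : ℝ, 0 < ε → ∃ g₀ η₀ : ℝ, 0 < g₀ ∧ 0 < η₀ ∧ ∃ L₀ : ℕ, ∀ L : ℕ, L₀ ≤ L →
      quarticMass L ≤ g₀ * bV L ^ 2 →
      sexticCumulant L ^ 2 ≤ η₀ * (bV L * quarticMass L) ^ 2 →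
      (1 - ε) * (quarticMass L * treeBox (2 * L)) ≤ quarticMass (2 * L) * treeBox L)
    (hB : (∃ c : ℝ, 0 < c ∧ ∀ x : Site 3, x ≠ 0 → c / ‖x‖ ≤ criticalTwoPoint 3 x) →
      ∀ (ρ : ℝ → ℝ) (S : CorrFamily 3), (∀ δ ∈ Set.Ioc (0:ℝ) 1, 0 < ρ δ) →
        HasPointwiseScalingLimit (criticalCorr 3) ρ S → IsNondegenerateTwoPoint S →
        Tendsto (fun L : ℕ => treeBox (2 * L) * bV L ^ 2 / (treeBox L * bV (2 * L) ^ 2)) atTop (𝓝 2))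
    (hC : ∃ C₆ : ℝ, 0 ≤ C₆ ∧ ∀ L : ℕ, sexticCumulant L ^ 2 ≤ C₆ * quarticMass L ^ 3) :
    (∃ c : ℝ, 0 < c ∧ ∀ x : Site 3, x ≠ 0 → c / ‖x‖ ≤ criticalTwoPoint 3 x) →
      ∀ (ρ : ℝ → ℝ) (S : CorrFamily 3), (∀ δ ∈ Set.Ioc (0:ℝ) 1, 0 < ρ δ) →
        HasPointwiseScalingLimit (criticalCorr 3) ρ S → IsNondegenerateTwoPoint S → HasNontrivialU4 S := by
  intro hCoul ρ S hρ hlim hnd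
  by_contra hU4
  -- landed: two-sided block variance and `g_L → 0` under a Gaussian non-degenerate limit
  have hVar :=
    Summit.CriticalPhenomena.Ising3DConformalLimit.PerfectScreeningCoulombImpliesNontrivial.stub_blockVariance hCoul
  have htend : Tendsto (fun L : ℕ => binder L) atTop (𝓝 0) :=
    Summit.CriticalPhenomena.Ising3DConformalLimit.PerfectScreeningCoulombImpliesNontrivial.stub_gaussianKillsBinder
      hVar ρ S hρ hlim hnd hU4
  obtain ⟨cv, Cv, hcv, hVb⟩ := hVar
  have hVpos : ∀ L : ℕ, 1 ≤ L → 0 < bV L := fun L hL => by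
    have h := (hVb L hL).1
    have hL' : (0 : ℝ) < L := by exact_mod_cast hL
    have h0 : (0 : ℝ) < cv * (L : ℝ) ^ 5 := by positivity
    exact lt_of_lt_of_le h0 h
  have hFpos : ∀ L : ℕ, 1 ≤ L → 0 < quarticMass L := fun L hL => by
    have := two_mul_bV_le_quarticMass L
    linarith [hVpos L hL]
  have hgpos : ∀ L : ℕ, 1 ≤ L → 0 < binder L := fun L hL =>
    div_pos (hFpos L hL) (pow_pos (hVpos L hL) 2)
  -- the constants
  obtain ⟨C₆, hC₆, hC6⟩ := hC
  obtain ⟨g₀, η₀, hg₀, hη₀, L₀, hA4⟩ := hA (1 / 4) (by norm_num)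
  have hr : Tendsto (fun L : ℕ => treeBox (2 * L) * bV L ^ 2 / (treeBox L * bV (2 * L) ^ 2)) atTop (𝓝 2) :=
    hB hCoul ρ S hρ hlim hnd
  set g₁ : ℝ := min g₀ (η₀ / (C₆ + 1)) with hg₁
  have hC₆1 : 0 < C₆ + 1 := by linarith
  have hg₁pos : 0 < g₁ := lt_min hg₀ (div_pos hη₀ hC₆1)
  have hg₁g₀ : g₁ ≤ g₀ := min_le_left _ _
  have hg₁η : g₁ * (C₆ + 1) ≤ η₀ := by
    have : g₁ ≤ η₀ / (C₆ + 1) := min_le_right _ _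
    rwa [le_div_iff₀ hC₆1] at this
  -- eventually: `g_L < g₁`, ratio `> 3/2`, `L ≥ L₀`, `L ≥ 1`
  have hev₁ : ∀ᶠ L : ℕ in atTop, binder L < g₁ := htend (Iio_mem_nhds hg₁pos)
  have hev₂ : ∀ᶠ L : ℕ in atTop,
      (3 / 2 : ℝ) < treeBox (2 * L) * bV L ^ 2 / (treeBox L * bV (2 * L) ^ 2) :=
    hr (Ioi_mem_nhds (by norm_num))
  obtain ⟨L₂, hL₂⟩ := eventually_atTop.1
    (hev₁.and (hev₂.and ((eventually_ge_atTop L₀).and (eventually_ge_atTop 1))))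
  -- KEY STEP: for `L ≥ L₂`, `g_L ≤ g_{2L}`
  have hstep : ∀ L : ℕ, L₂ ≤ L → binder L ≤ binder (2 * L) := by
    intro L hL
    obtain ⟨h1, h2, h3, h4⟩ := hL₂ L hL
    have hL1 : 1 ≤ L := h4
    have h2L1 : 1 ≤ 2 * L := by omega
    have hV0 := hVpos L hL1
    have hV2 := hVpos (2 * L) h2L1
    have hF0 := hFpos L hL1
    have hT0 := treeBox_pos L
    have hT2 := treeBox_pos (2 * L)
    have hgF : quarticMass L ≤ g₁ * bV L ^ 2 := by
      have : binder L ≤ g₁ := le_of_lt h1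
      unfold binder at this
      rwa [div_le_iff₀ (pow_pos hV0 2)] at this
    have hgle : quarticMass L ≤ g₀ * bV L ^ 2 :=
      hgF.trans (mul_le_mul_of_nonneg_right hg₁g₀ (sq_nonneg _))
    have hslave : sexticCumulant L ^ 2 ≤ η₀ * (bV L * quarticMass L) ^ 2 := by
      have hK := hC6 L
      have hF0' : 0 ≤ quarticMass L := hF0.le
      calc sexticCumulant L ^ 2 ≤ C₆ * quarticMass L ^ 3 := hK
        _ = (C₆ * quarticMass L) * quarticMass L ^ 2 := by ring
        _ ≤ (C₆ * (g₁ * bV L ^ 2)) * quarticMass L ^ 2 := by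
            apply mul_le_mul_of_nonneg_right _ (sq_nonneg _)
            exact mul_le_mul_of_nonneg_left hgF hC₆
        _ = (g₁ * C₆) * (bV L * quarticMass L) ^ 2 := by ring
        _ ≤ η₀ * (bV L * quarticMass L) ^ 2 := by
            apply mul_le_mul_of_nonneg_right _ (sq_nonneg _)
            nlinarith [hg₁η, hg₁pos, hC₆]
    have hAL := hA4 L h3 hgle hslave
    have hratio : (3 / 2 : ℝ) * (treeBox L * bV (2 * L) ^ 2) ≤ treeBox (2 * L) * bV L ^ 2 := by
      have hden : 0 < treeBox L * bV (2 * L) ^ 2 := mul_pos hT0 (pow_pos hV2 2)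
      exact (le_div_iff₀ hden).1 (le_of_lt h2)
    -- `F(2L)·T(L)·V_L² ≥ (3/4)·F(L)·T(2L)·V_L² ≥ (3/4)(3/2)·F(L)·T(L)·V_{2L}²`
    have e1 : quarticMass L * ((3 / 2 : ℝ) * (treeBox L * bV (2 * L) ^ 2)) ≤
        quarticMass L * (treeBox (2 * L) * bV L ^ 2) :=
      mul_le_mul_of_nonneg_left hratio hF0.le
    have e2 : (1 - 1 / 4 : ℝ) * (quarticMass L * treeBox (2 * L)) * bV L ^ 2 ≤
        quarticMass (2 * L) * treeBox L * bV L ^ 2 :=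
      mul_le_mul_of_nonneg_right hAL (sq_nonneg _)
    have e3 : (9 / 8 : ℝ) * (quarticMass L * bV (2 * L) ^ 2) * treeBox L ≤
        (quarticMass (2 * L) * bV L ^ 2) * treeBox L := by
      nlinarith [e1, e2]
    have e4 : (9 / 8 : ℝ) * (quarticMass L * bV (2 * L) ^ 2) ≤ quarticMass (2 * L) * bV L ^ 2 :=
      le_of_mul_le_mul_right e3 hT0
    have key : quarticMass L * bV (2 * L) ^ 2 ≤ quarticMass (2 * L) * bV L ^ 2 := by
      nlinarith [e4, hF0.le, sq_nonneg (bV (2 * L))]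
    unfold binder
    rw [div_le_div_iff₀ (pow_pos hV0 2) (pow_pos hV2 2)]
    linarith [key]
  -- iterate along `2^k L₃`
  obtain ⟨L₃, hL₃, hL₃1⟩ : ∃ L₃ : ℕ, L₂ ≤ L₃ ∧ 1 ≤ L₃ := ⟨max L₂ 1, le_max_left _ _, le_max_right _ _⟩
  have hiter : ∀ k : ℕ, binder L₃ ≤ binder (2 ^ k * L₃) := by
    intro k
    induction k with
    | zero => rw [pow_zero, one_mul]
    | succ k ih =>
      have hpk : 1 ≤ 2 ^ k := Nat.one_le_two_pow
      have hk : L₂ ≤ 2 ^ k * L₃ := by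
        calc L₂ ≤ L₃ := hL₃
          _ = 1 * L₃ := (one_mul _).symm
          _ ≤ 2 ^ k * L₃ := Nat.mul_le_mul_right _ hpk
      have heq : 2 ^ (k + 1) * L₃ = 2 * (2 ^ k * L₃) := by rw [pow_succ]; ring
      calc binder L₃ ≤ binder (2 ^ k * L₃) := ih
        _ ≤ binder (2 * (2 ^ k * L₃)) := hstep _ hk
        _ = binder (2 ^ (k + 1) * L₃) := by rw [heq]
  -- the subsequence tends to `0`, yet stays above `g_{L₃} > 0`
  have hseq : Tendsto (fun k : ℕ => 2 ^ k * L₃) atTop atTop := by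
    refine tendsto_atTop_mono (fun k => ?_) tendsto_id
    calc id k = k := rfl
      _ ≤ 2 ^ k := (Nat.lt_two_pow_self).le
      _ = 2 ^ k * 1 := (mul_one _).symm
      _ ≤ 2 ^ k * L₃ := Nat.mul_le_mul_left _ hL₃1
  have hsub : Tendsto (fun k : ℕ => binder (2 ^ k * L₃)) atTop (𝓝 0) := htend.comp hseq
  have hg3 : 0 < binder L₃ := hgpos L₃ hL₃1
  have hev₃ : ∀ᶠ k : ℕ in atTop, binder (2 ^ k * L₃) < binder L₃ := (tendsto_order.1 hsub).2 _ hg3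
  obtain ⟨k, hk⟩ := hev₃.exists
  exact absurd (hiter k) (not_le.2 hk)

/-- **`CoulombImpliesNontrivial_of`** — the line applied to its own stubs: the crux
`Summit.CriticalPhenomena.Ising3DConformalLimit.Theses.PerfectScreening.CoulombImpliesNontrivial` BY NAME,
modulo exactly the three registered `stub_*` above (A `stub_vertexQuasiMonotone`, B `stub_treeScaleRatio`,
C `stub_newmanSixth`). -/
theorem CoulombImpliesNontrivial_of :
    Summit.CriticalPhenomena.Ising3DConformalLimit.Theses.PerfectScreening.CoulombImpliesNontrivial :=
  crux_of_vertexQuasiMonotone stub_vertexQuasiMonotone stub_treeScaleRatio stub_newmanSixth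

end Summit.CriticalPhenomena.Ising3DConformalLimit.Cruxes.CoulombImpliesNontrivial.QuarticRelevance

end
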